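import Literature.NumberTheory.EllipticCurves.RingClassFieldCubeRoots
import HarnessLib

/-!
# Hu–Shu–Yin's radicals inside the Sylvester tower: `∛3, ∛p, ∛(3p) ∈ K[9pn]`, and the subgroup
# fixing `K[9pn]` fixes every cube root of `p/9` and of `p²/3` (Prop. 2.4; recipe inputs `hNN'`, `hN'c`)

Topic `NumberTheory/EllipticCurves/HuShuYin2019`; namespace
`Literature.NumberTheory.EllipticCurves.HuShuYin2019`. THEOREMS only (no definition, no named fact, no
instance; D-0026), unconditional: instantiations of `cubeRoot_natCast_mem_ringClassField`
(`RingClassFieldCubeRoots.lean`) in the shapes displayed by the CM-frame recipe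
`HuShuYin2019.exists_cmFrame_kolyvaginClass` (`CubicTwistKolyvaginClassesJZero.lean`): there the curve
`B = E_p = (E_9)^χ` is reached through `b = 9c`, `c = p/9`, `v³ = c`, and `A = E_{3p²}` through
`c = p²/3`; the recipe asks for a subgroup `N' ≥ N = Gal(K̄/K[9pn])` fixing every cube root `w` of `c`
(`hN'c`) — with the present file one may take generators of `L_{(3,p)} = K(∛3, ∛p)` INSIDE `K[9pn]`
(`exists_pow_three_eq_three`, `exists_pow_three_eq_natCast`; or directly the cube roots
`exists_pow_three_eq_natCast_div_nine`, `exists_pow_three_eq_sq_div_three` + `JZero.apply_eq_self_of_cubeRoot`),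
so that `N ≤ N'` is immediate, and `N`
itself fixes the cube roots of `p/9` and `p²/3` (`forall_apply_eq_of_pow_three_eq_div_nine`,
`forall_apply_eq_of_pow_three_eq_sq_div_three`; `v = ∛(p/9) = ∛(3p)/3`, `∛(p²/3) = (∛(3p))²/3`).

Setting (route binders): `K` a number field with `ω² + ω + 1 = 0`, `[K : ℚ] = 2` (`K = ℚ(ω)`),
`ι : K → ℂ`, `p, n ≥ 1` (NO congruence hypothesis on `p` is needed for these containments),
`emb : K[9pn] → K̄` over `K`, and ANY subgroup `N` of `Γ_K = Gal(K̄/K)` with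
`g ∈ N ↔ g ∘ emb = emb` (as in `SylvesterTowerTwoTorsion.pow_three_ne_six_of_forall_apply_eq`).

HONEST FRAMING: classical CM/class field theory (`K(∛3) = H_9`, `K(∛p) ⊂ H_{3p}`,
`L_{(3,p)} ⊂ H_{9p} ⊂ H_{9pn}`), proved on the tree's class field theory; nothing about elliptic curves
or any summit statement is asserted here.

## References

* Y. Hu, J. Shu, H. Yin, *An explicit Gross–Zagier formula related to the Sylvester conjecture*,
  Trans. AMS 372 (2019), §1 p. 4 (`χ(σ) = (∛(3p))^{σ−1}`), §2 Prop. 2.4 (1) and the field diagram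
  following it (arXiv:1708.05266 p. 7). [HuShuYin2019]
* D. A. Cox, *Primes of the form x² + ny²*, 2nd ed. (2013), §9.A. [Cox2013]

## Mathlib / tree search

Tree: `cubeRoot_three_mem_ringClassField`, `cubeRoot_mem_ringClassField_nine_mul`,
`cubeRoot_three_mul_mem_ringClassField`, `apply_mem_ringClassField`, `JZero.exists_aut_apply_eq_sq`,
`Kummer.exists_eq_pow_mul_of_pow_three_eq`. Mathlib: `IsAlgClosed.exists_pow_nat_eq`, `map_ratCast`.
-/

noncomputable section

open NumberField
open scoped Classical

namespace Literature.NumberTheory.EllipticCurves.HuShuYin2019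

open Literature.NumberTheory.EllipticCurves

variable {K : Type} [Field K] [NumberField K]

/-! ### Cube roots of `3`, `p`, `3p` as ELEMENTS of `K[9pn]` -/

/-- **`∛3 ∈ K[9pn]`** as an element: `∃ x : K[9pn], x³ = 3` (`K(∛3) = H_9 ⊆ H_{9pn}`).
[cite: HuShuYin2019, §2 Prop. 2.4 (1) and field diagram (arXiv p. 7)] -/
theorem exists_pow_three_eq_three {ω : K} (hω : ω ^ 2 + ω + 1 = 0) (h2 : Module.finrank ℚ K = 2)
    (ι : K →+* ℂ) {p n : ℕ} (hp : p ≠ 0) (hn : n ≠ 0) :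
    ∃ x : ringClassField K ι (9 * p * n), x ^ 3 = 3 := by
  obtain ⟨r, hr⟩ := IsAlgClosed.exists_pow_nat_eq (3 : ℂ) (by norm_num : 0 < 3)
  have hmem := cubeRoot_three_mem_ringClassField hω h2 ι (mul_ne_zero hp hn) r hr
  rw [← mul_assoc] at hmem
  exact ⟨⟨r, hmem⟩, Subtype.ext (by push_cast; exact hr)⟩

/-- **`∛p ∈ K[9pn]`** as an element: `∃ x : K[9pn], x³ = p` (`K(∛p) ⊆ H_{3p} ⊆ H_{9pn}`).
[cite: HuShuYin2019, §2 Prop. 2.4 and field diagram (arXiv p. 7)] -/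
theorem exists_pow_three_eq_natCast {ω : K} (hω : ω ^ 2 + ω + 1 = 0) (h2 : Module.finrank ℚ K = 2)
    (ι : K →+* ℂ) {p n : ℕ} (hp : p ≠ 0) (hn : n ≠ 0) :
    ∃ x : ringClassField K ι (9 * p * n), x ^ 3 = (p : ringClassField K ι (9 * p * n)) := by
  obtain ⟨r, hr⟩ := IsAlgClosed.exists_pow_nat_eq (p : ℂ) (by norm_num : 0 < 3)
  exact ⟨⟨r, cubeRoot_mem_ringClassField_nine_mul hω h2 ι hp hn r hr⟩,
    Subtype.ext (by push_cast; exact hr)⟩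

/-- **`∛(3p) ∈ K[9pn]`** as an element: `∃ x : K[9pn], x³ = 3p` (`L_{(3p)} ⊆ H_{9p} ⊆ H_{9pn}`).
[cite: HuShuYin2019, §1 p. 4 and §2 field diagram (arXiv p. 7)] -/
theorem exists_pow_three_eq_three_mul {ω : K} (hω : ω ^ 2 + ω + 1 = 0)
    (h2 : Module.finrank ℚ K = 2) (ι : K →+* ℂ) {p n : ℕ} (hp : p ≠ 0) (hn : n ≠ 0) :
    ∃ x : ringClassField K ι (9 * p * n), x ^ 3 = 3 * (p : ringClassField K ι (9 * p * n)) := by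
  obtain ⟨r, hr⟩ := IsAlgClosed.exists_pow_nat_eq (3 * (p : ℂ)) (by norm_num : 0 < 3)
  exact ⟨⟨r, cubeRoot_three_mul_mem_ringClassField hω h2 ι hp hn r hr⟩,
    Subtype.ext (by push_cast; exact hr)⟩

/-- **`∛(p/9) ∈ K[9pn]`** as an element: `∃ v₀ : K[9pn], v₀³ = p/9` (`v₀ = ∛(3p)/3`; the `v` of the
transport `E_9 ≅ E_p`, `b = p = 9c`). [cite: HuShuYin2019, §2 p. 8 (E_b ≅ E_{c²b} via v³ = c) and Prop. 2.4] -/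
theorem exists_pow_three_eq_natCast_div_nine {ω : K} (hω : ω ^ 2 + ω + 1 = 0)
    (h2 : Module.finrank ℚ K = 2) (ι : K →+* ℂ) {p n : ℕ} (hp : p ≠ 0) (hn : n ≠ 0) :
    ∃ v₀ : ringClassField K ι (9 * p * n),
      v₀ ^ 3 = (p : ringClassField K ι (9 * p * n)) / 9 := by
  obtain ⟨r, hr⟩ := IsAlgClosed.exists_pow_nat_eq (3 * (p : ℂ)) (by norm_num : 0 < 3)
  have hrmem : r ∈ ringClassField K ι (9 * p * n) :=
    cubeRoot_three_mul_mem_ringClassField hω h2 ι hp hn r hr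
  have h3mem : (3 : ℂ) ∈ ringClassField K ι (9 * p * n) := by
    have h := apply_mem_ringClassField ι (9 * p * n) (3 : K)
    rwa [map_ofNat] at h
  refine ⟨⟨r / 3, div_mem hrmem h3mem⟩, Subtype.ext ?_⟩
  have e : (((p : ringClassField K ι (9 * p * n)) / 9 : ringClassField K ι (9 * p * n)) : ℂ) =
      (p : ℂ) / 9 := by norm_cast
  rw [SubmonoidClass.coe_pow, e]
  show (r / 3) ^ 3 = _
  rw [div_pow, hr]
  ring

/-- **`∛(p²/3) ∈ K[9pn]`** as an element: `∃ v₀ : K[9pn], v₀³ = p²/3` (`v₀ = (∛(3p))²/3`; the `v` of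
`E_9 ≅ E_{3p²}`, `b = 3p² = 9c`). [cite: HuShuYin2019, §2 p. 8 and Prop. 2.4] -/
theorem exists_pow_three_eq_sq_div_three {ω : K} (hω : ω ^ 2 + ω + 1 = 0)
    (h2 : Module.finrank ℚ K = 2) (ι : K →+* ℂ) {p n : ℕ} (hp : p ≠ 0) (hn : n ≠ 0) :
    ∃ v₀ : ringClassField K ι (9 * p * n),
      v₀ ^ 3 = (p : ringClassField K ι (9 * p * n)) ^ 2 / 3 := by
  obtain ⟨r, hr⟩ := IsAlgClosed.exists_pow_nat_eq (3 * (p : ℂ)) (by norm_num : 0 < 3)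
  have hrmem : r ∈ ringClassField K ι (9 * p * n) :=
    cubeRoot_three_mul_mem_ringClassField hω h2 ι hp hn r hr
  have h3mem : (3 : ℂ) ∈ ringClassField K ι (9 * p * n) := by
    have h := apply_mem_ringClassField ι (9 * p * n) (3 : K)
    rwa [map_ofNat] at h
  refine ⟨⟨r ^ 2 / 3, div_mem (pow_mem hrmem 2) h3mem⟩, Subtype.ext ?_⟩
  have e : (((p : ringClassField K ι (9 * p * n)) ^ 2 / 3 : ringClassField K ι (9 * p * n)) : ℂ) =
      (p : ℂ) ^ 2 / 3 := by norm_cast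
  rw [SubmonoidClass.coe_pow, e]
  show (r ^ 2 / 3) ^ 3 = _
  rw [div_pow, ← pow_mul, show 2 * 3 = 3 * 2 from rfl, pow_mul, hr]
  ring

/-! ### The subgroup fixing `K[m]` fixes the cube roots of `c` once ONE of them lies in `K[m]` -/

/-- **Transfer to `K̄`.** Let `emb : K[m] → K̄` over `K` and `N ≤ Γ_K` act trivially on `emb(K[m])`
(only this direction of `g ∈ N ↔ g ∘ emb = emb` is used, so any SMALLER-field fixing subgroup `N' ⊇ N`
that still fixes `emb z` may be fed through `N := N'` with the obvious `hN`). If `z ∈ K[m]` has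
`z³ = c ∈ ℚ` (in `ℂ`), then every `w ∈ K̄` with `w³ = c` is fixed by `N`: the cube roots of `c` in `K̄`
are `emb(ω^i z)` (`ω ∈ K`). This is the shape of the recipe hypothesis `hN'c` of
`HuShuYin2019.exists_cmFrame_kolyvaginClass` (compare `JZero.apply_eq_self_of_cubeRoot`).
[cite: HuShuYin2019, §2 Prop. 2.4] [cite: Cox2013, §9.A] -/
theorem forall_apply_eq_of_coe_pow_three_eq {ω : K} (hω : ω ^ 2 + ω + 1 = 0)
    (h2 : Module.finrank ℚ K = 2) (ι : K →+* ℂ) {m : ℕ}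
    (emb : ringClassField K ι m →+* AlgebraicClosure K)
    (hemb : ∀ k : K, emb (algebraMap K (ringClassField K ι m) k) = algebraMap K (AlgebraicClosure K) k)
    (N : Subgroup (Field.absoluteGaloisGroup K))
    (hN : ∀ g ∈ N, ∀ x : ringClassField K ι m,
      (show AlgebraicClosure K ≃ₐ[K] AlgebraicClosure K from g) (emb x) = emb x)
    {c : ℚ} {z : ringClassField K ι m} (hz : (z : ℂ) ^ 3 = (c : ℂ)) :
    ∀ h ∈ N, ∀ w : AlgebraicClosure K, w ^ 3 = algebraMap ℚ (AlgebraicClosure K) c →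
      (show AlgebraicClosure K ≃ₐ[K] AlgebraicClosure K from h) w = w := by
  intro h hh w hw
  -- `emb z` is a cube root of `c` in `K̄`
  have hz' : z ^ 3 = (c : ringClassField K ι m) := by
    apply Subtype.ext
    rw [SubmonoidClass.coe_pow, hz]
    norm_cast
  have hθ : emb z ^ 3 = algebraMap ℚ (AlgebraicClosure K) c := by
    rw [← map_pow, hz', map_ratCast, eq_ratCast]
  by_cases hc : c = 0
  · subst hc
    have hw0 : w = 0 := by simpa using hw
    rw [hw0, map_zero]
  have hθ0 : emb z ≠ 0 := by
    intro h0
    rw [h0, zero_pow three_ne_zero, eq_comm, map_eq_zero] at hθ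
    exact hc hθ
  have hζ : IsPrimitiveRoot (algebraMap K (AlgebraicClosure K) ω) 3 :=
    ((JZero.exists_aut_apply_eq_sq K hω h2).1).map_of_injective (algebraMap K _).injective
  obtain ⟨i, -, hi⟩ := Kummer.exists_eq_pow_mul_of_pow_three_eq hζ hθ0 (hw.trans hθ.symm)
  have hwemb : w = emb (algebraMap K (ringClassField K ι m) ω ^ i * z) := by
    rw [map_mul, map_pow, hemb, hi]
  rw [hwemb]
  exact hN h hh _

/-- **`Gal(K̄/K[9pn])` fixes every cube root of `p/9`** (the `c` of `E_p = (E_9)^χ`, `b = p = 9c`;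
`v = ∛(p/9) = ∛(3p)/3 ∈ K[9pn]`): the `hN'c`-shape of the CM-frame recipe, for `N' := N` or any larger
subgroup. [cite: HuShuYin2019, §2 Prop. 2.4 (1), field diagram (arXiv p. 7) and §2 p. 8 (E_9 ≅ E_p over L)] -/
theorem forall_apply_eq_of_pow_three_eq_div_nine {ω : K} (hω : ω ^ 2 + ω + 1 = 0)
    (h2 : Module.finrank ℚ K = 2) (ι : K →+* ℂ) {p n : ℕ} (hp : p ≠ 0) (hn : n ≠ 0)
    (emb : ringClassField K ι (9 * p * n) →+* AlgebraicClosure K)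
    (hemb : ∀ k : K, emb (algebraMap K (ringClassField K ι (9 * p * n)) k) =
      algebraMap K (AlgebraicClosure K) k)
    (N : Subgroup (Field.absoluteGaloisGroup K))
    (hN : ∀ g : Field.absoluteGaloisGroup K, g ∈ N ↔
      ∀ x : ringClassField K ι (9 * p * n),
        (show AlgebraicClosure K ≃ₐ[K] AlgebraicClosure K from g) (emb x) = emb x) :
    ∀ h ∈ N, ∀ w : AlgebraicClosure K, w ^ 3 = algebraMap ℚ (AlgebraicClosure K) ((p : ℚ) / 9) →
      (show AlgebraicClosure K ≃ₐ[K] AlgebraicClosure K from h) w = w := by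
  obtain ⟨r, hr⟩ := IsAlgClosed.exists_pow_nat_eq (3 * (p : ℂ)) (by norm_num : 0 < 3)
  have hrmem : r ∈ ringClassField K ι (9 * p * n) :=
    cubeRoot_three_mul_mem_ringClassField hω h2 ι hp hn r hr
  have h3mem : (3 : ℂ) ∈ ringClassField K ι (9 * p * n) := by
    have h := apply_mem_ringClassField ι (9 * p * n) (3 : K)
    rwa [map_ofNat] at h
  refine forall_apply_eq_of_coe_pow_three_eq hω h2 ι emb hemb N (fun g hg ↦ (hN g).mp hg)
    (z := ⟨r / 3, div_mem hrmem h3mem⟩) (c := (p : ℚ) / 9) ?_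
  show (r / 3) ^ 3 = (((p : ℚ) / 9 : ℚ) : ℂ)
  rw [div_pow, hr]
  push_cast
  ring

/-- **`Gal(K̄/K[9pn])` fixes every cube root of `p²/3`** (the `c` of `E_{3p²} = (E_9)^{χ²}`,
`b = 3p² = 9c`; `∛(p²/3) = (∛(3p))²/3 ∈ K[9pn]`).
[cite: HuShuYin2019, §2 Prop. 2.4 (1), field diagram (arXiv p. 7)] -/
theorem forall_apply_eq_of_pow_three_eq_sq_div_three {ω : K} (hω : ω ^ 2 + ω + 1 = 0)
    (h2 : Module.finrank ℚ K = 2) (ι : K →+* ℂ) {p n : ℕ} (hp : p ≠ 0) (hn : n ≠ 0)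
    (emb : ringClassField K ι (9 * p * n) →+* AlgebraicClosure K)
    (hemb : ∀ k : K, emb (algebraMap K (ringClassField K ι (9 * p * n)) k) =
      algebraMap K (AlgebraicClosure K) k)
    (N : Subgroup (Field.absoluteGaloisGroup K))
    (hN : ∀ g : Field.absoluteGaloisGroup K, g ∈ N ↔
      ∀ x : ringClassField K ι (9 * p * n),
        (show AlgebraicClosure K ≃ₐ[K] AlgebraicClosure K from g) (emb x) = emb x) :
    ∀ h ∈ N, ∀ w : AlgebraicClosure K, w ^ 3 = algebraMap ℚ (AlgebraicClosure K) ((p : ℚ) ^ 2 / 3) →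
      (show AlgebraicClosure K ≃ₐ[K] AlgebraicClosure K from h) w = w := by
  obtain ⟨r, hr⟩ := IsAlgClosed.exists_pow_nat_eq (3 * (p : ℂ)) (by norm_num : 0 < 3)
  have hrmem : r ∈ ringClassField K ι (9 * p * n) :=
    cubeRoot_three_mul_mem_ringClassField hω h2 ι hp hn r hr
  have h3mem : (3 : ℂ) ∈ ringClassField K ι (9 * p * n) := by
    have h := apply_mem_ringClassField ι (9 * p * n) (3 : K)
    rwa [map_ofNat] at h
  refine forall_apply_eq_of_coe_pow_three_eq hω h2 ι emb hemb N (fun g hg ↦ (hN g).mp hg)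
    (z := ⟨r ^ 2 / 3, div_mem (pow_mem hrmem 2) h3mem⟩) (c := (p : ℚ) ^ 2 / 3) ?_
  show (r ^ 2 / 3) ^ 3 = (((p : ℚ) ^ 2 / 3 : ℚ) : ℂ)
  rw [div_pow, ← pow_mul, show 2 * 3 = 3 * 2 from rfl, pow_mul, hr]
  push_cast
  ring

end Literature.NumberTheory.EllipticCurves.HuShuYin2019

end
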